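import Summits.AtomisticToContinuum.FouriersLaw.Theorems.BondHeatUncertaintyExtensiveSnapshotIrreversibilityEnergyWindowSkeletonWeights
import Summits.AtomisticToContinuum.FouriersLaw.Theorems.BondHeatUncertaintyExtensiveSnapshotIrreversibilityEnergyWindowSkeletonGaussianIBP

/-!
# Crux `ExtensiveSnapshotIrreversibility` (stmt-AtomisticToContinuum-9121): skeleton
refinement at time `s` and Loewner monotonicity of the normalised Gram matrices

Cell decomp-a2c, lens «grading / quantitative ladder», generation 78, part S, file 3 of 4
(critic row 1077 (d): «(I-s5) refinement identity + Loewner monotonicity `Γ_m ≤ Γ_{m+1}`»).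
Imports part R (`…EnergyWindowSkeletonWeights`: `skelFlowMapAt`, `skelJacAt`, `skelGramAt`,
`skelSkorokhod`, …) and part S file 2 (`…EnergyWindowSkeletonGaussianIBP`).  Everything here
is PROVED; no new leaves; file 4 (`…EnergyWindowSkeletonDefect`) turns §3 into the critic's
`defect_sq_le` / `tendsto_defect`.

§1 THE SKELETON INTEGRATION BY PARTS IN THE NOTATION OF PART R: file 2's divergence-form
identities with the bracket written as R's `skelSkorokhod m u` (`skelGauss_ibp_skorokhod`,
`wienerPair_skeleton_ibp_skorokhod`) — by `simp only [skelSkorokhod, skelDiv]`.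
§2 (I-s5) REFINEMENT AT TIME `s`.  The children `childFin m k i = 2k+i` of a level-`m` index,
the regrouping `Σ_{j' < 2^{m+1}} f(j') = Σ_{k < 2^m} (f(2k) + f(2k+1))` (`sum_childFin`,
`sum_childIdx`), the refinement `refinePair` of a skeleton perturbation (the tree's `refineIncr`
on both baths) with `refinePair (basisX m j) = ½ (basisX (m+1) j₀ + basisX (m+1) j₁)`
(`refinePair_basisX`), and the REFINEMENT IDENTITY along the driving path,
`D E^{s}_{m+1}(Ξ_{m+1} wp)[refinePair δ] = D E^{s}_m(Ξ_m wp)[δ]` for every `s ∈ [0, 1]`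
(`fderiv_skelFlowMapAt_refinePair`: the tree's `range_fderiv_skelFlowMap_mono`, which is
`s = 1` and ranges only, ported to time `s` and stated as an identity — same forcing after
refinement (`skelForcing_refine`), hence the same variational solution (`variational_unique`)).
§3 LOEWNER MONOTONICITY.  The quadratic form of R's normalised Gram matrix is
`gᵀ Γ^{s}_m g = 2^{-m} Σ_j ⟨c_g, D E^{s}_m[b_j]⟩²` (`dotProduct_skelGramAt_mulVec`); by §2 each
level-`m` pairing is the mean of its two children's (`dualPair_fderiv_basisX_refine`) and
`(½(a+b))² ≤ ½(a²+b²)`, so along the path `gᵀ Γ_m g ≤ gᵀ Γ_{m+1} g`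
(`dotProduct_skelGramAt_mulVec_le_succ`) and `Γ_m − Γ_{m'} ⪰ 0` for `m' ≤ m`
(`dotProduct_skelGramPath_mulVec_mono`, `posSemidef_skelGramPath_sub`, with
`skelGramPath … m z wp = Γ^{s}_m` along the path); and ONTO ⟹ `Γ ≻ 0`
(`posDef_skelGramAt_of_range_eq_top` — the hook through which (I-s2) at time `s`,
generation 80, enters file 4; the tree has the case `s = 1`:
`exists_forall_range_fderiv_skelFlowMap_eq_top`).
No new instance / notation / option.
References: D. Nualart, The Malliavin Calculus and Related Topics (2006), §2.3 (Malliavin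
matrix of a finite-dimensional approximation); J.-P. Eckmann, M. Hairer, Comm. Math. Phys. 212
(2000) 105, §3. [folklore]
-/

noncomputable section

namespace Summit.AtomisticToContinuum.FouriersLaw.Theorems.ExtensiveSnapshotIrreversibility.EnergyWindow

open MeasureTheory ProbabilityTheory Filter Topology Set
open scoped ENNReal NNReal Matrix
open Literature.MathematicalPhysics.KineticTheory.HeatConduction
open Literature.Probability.Process

/-! ## 1. The skeleton integration by parts in the notation of part R -/

section Skorokhod

variable (m : ℕ)

/-- **(I-s4) in R's notation**: `∫ G · δ_m(u) d skelGauss = 2^{-m} ∫ Σ_j (∂_j G) u_j d skelGauss`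
with `δ_m = skelSkorokhod m` (file 2 `skelGauss_ibp_div`). [cite: Nualart2006, Prop 1.3.1] -/
theorem skelGauss_ibp_skorokhod {G : PairSkeleton m → ℝ}
    {u : PairSkeleton m → Fin (2 ^ m) ⊕ Fin (2 ^ m) → ℝ}
    (hG : Differentiable ℝ G) (hu : ∀ j, Differentiable ℝ fun y => u y j)
    (hGu : ∀ j, Integrable (fun x => G x * u x j) (skelGauss m))
    (hxGu : ∀ j, Integrable (fun x => coordX m x j * (G x * u x j)) (skelGauss m))
    (hdGu : ∀ j, Integrable (fun x => fderiv ℝ G x (basisX m j) * u x j) (skelGauss m))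
    (hGdu : ∀ j, Integrable (fun x => G x * fderiv ℝ (fun y => u y j) x (basisX m j))
      (skelGauss m)) :
    ∫ x, G x * skelSkorokhod m u x ∂(skelGauss m) =
      ((2 : ℝ) ^ m)⁻¹ * ∫ x, ∑ j, fderiv ℝ G x (basisX m j) * u x j ∂(skelGauss m) := by
  simp only [skelSkorokhod, skelDiv]
  exact skelGauss_ibp_div m hG hu hGu hxGu hdGu hGdu

/-- **(I-s4) under `E`, in R's notation**: `E[G(Ξ,R) δ_m(u(·,R))(Ξ)] = 2^{-m} E[Σ_j ∂_jG u_j]`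
(file 2 `wienerPair_skeleton_ibp_div`). [cite: Nualart2006, Prop 1.3.1] -/
theorem wienerPair_skeleton_ibp_skorokhod {G : PairSkeleton m × WienerPair → ℝ}
    {u : PairSkeleton m × WienerPair → Fin (2 ^ m) ⊕ Fin (2 ^ m) → ℝ}
    (hGm : Measurable G) (hum : ∀ j, Measurable fun p => u p j)
    (hdGm : ∀ j, Measurable fun p : PairSkeleton m × WienerPair =>
      fderiv ℝ (fun y => G (y, p.2)) p.1 (basisX m j))
    (hdum : ∀ j, Measurable fun p : PairSkeleton m × WienerPair =>
      fderiv ℝ (fun y => u (y, p.2) j) p.1 (basisX m j))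
    (hGd : ∀ r, Differentiable ℝ fun y => G (y, r))
    (hud : ∀ r j, Differentiable ℝ fun y => u (y, r) j)
    (hGu : ∀ j, Integrable (fun wp => G (pairSkel m wp, pairRem m wp) *
      u (pairSkel m wp, pairRem m wp) j) wienerPair)
    (hxGu : ∀ j, Integrable (fun wp => coordX m (pairSkel m wp) j *
      (G (pairSkel m wp, pairRem m wp) * u (pairSkel m wp, pairRem m wp) j)) wienerPair)
    (hdGu : ∀ j, Integrable (fun wp =>
      fderiv ℝ (fun y => G (y, pairRem m wp)) (pairSkel m wp) (basisX m j) *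
        u (pairSkel m wp, pairRem m wp) j) wienerPair)
    (hGdu : ∀ j, Integrable (fun wp => G (pairSkel m wp, pairRem m wp) *
      fderiv ℝ (fun y => u (y, pairRem m wp) j) (pairSkel m wp) (basisX m j)) wienerPair) :
    ∫ wp, G (pairSkel m wp, pairRem m wp) *
        skelSkorokhod m (fun y => u (y, pairRem m wp)) (pairSkel m wp) ∂wienerPair =
      ((2 : ℝ) ^ m)⁻¹ * ∫ wp, ∑ j,
        fderiv ℝ (fun y => G (y, pairRem m wp)) (pairSkel m wp) (basisX m j) *
          u (pairSkel m wp, pairRem m wp) j ∂wienerPair := by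
  simp only [skelSkorokhod, skelDiv]
  exact wienerPair_skeleton_ibp_div m hGm hum hdGm hdum hGd hud hGu hxGu hdGu hGdu

end Skorokhod

/-! ## 2. (I-s5) Refinement at time `s` -/

section Refine

variable (m : ℕ)

/-- The two **children** `2k` (`i = 0`) and `2k+1` (`i = 1`) at level `m+1` of the level-`m`
index `k`. [folklore] -/
def childFin (k : Fin (2 ^ m)) (i : Fin 2) : Fin (2 ^ (m + 1)) :=
  ⟨2 * k.val + i.val, by
    have hk := k.isLt
    have hi := i.isLt
    rw [pow_succ]
    omega⟩

/-- The value of a child index. [folklore] -/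
@[simp] theorem childFin_val (k : Fin (2 ^ m)) (i : Fin 2) :
    (childFin m k i).val = 2 * k.val + i.val := rfl

/-- The children on either bath (same bath as the parent). [folklore] -/
def childIdx (i : Fin 2) :
    Fin (2 ^ m) ⊕ Fin (2 ^ m) → Fin (2 ^ (m + 1)) ⊕ Fin (2 ^ (m + 1)) :=
  Sum.map (fun k => childFin m k i) (fun k => childFin m k i)

/-- **Regrouping a level-`m+1` sum by parents**: `Σ_{j'} f j' = Σ_k (f (2k) + f (2k+1))`.
[folklore] -/
theorem sum_childFin (f : Fin (2 ^ (m + 1)) → ℝ) :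
    ∑ j, f j = ∑ k : Fin (2 ^ m), (f (childFin m k 0) + f (childFin m k 1)) := by
  have h2 : 2 ^ m * 2 = 2 ^ (m + 1) := (pow_succ 2 m).symm
  let e : Fin (2 ^ m) × Fin 2 ≃ Fin (2 ^ (m + 1)) := finProdFinEquiv.trans (finCongr h2)
  have he : ∀ k i, e (k, i) = childFin m k i := fun k i => Fin.ext (by
    simp [e, finProdFinEquiv, childFin]
    omega)
  rw [← Fintype.sum_equiv e (fun p => f (e p)) f fun _ => rfl, Fintype.sum_prod_type]
  simp only [Fin.sum_univ_two, he]

/-- The same regrouping on the two-bath index type. [folklore] -/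
theorem sum_childIdx (f : Fin (2 ^ (m + 1)) ⊕ Fin (2 ^ (m + 1)) → ℝ) :
    ∑ j, f j = ∑ j : Fin (2 ^ m) ⊕ Fin (2 ^ m), (f (childIdx m 0 j) + f (childIdx m 1 j)) := by
  simp only [Fintype.sum_sum_type, childIdx, Sum.map_inl, Sum.map_inr]
  rw [sum_childFin m (fun k => f (Sum.inl k)), sum_childFin m (fun k => f (Sum.inr k))]

/-- **Refinement of a skeleton perturbation**: the tree's `refineIncr` on both baths (the
level-`m+1` increments of the level-`m` piecewise-linear path). [folklore] -/
def refinePair (δ : PairSkeleton m) : PairSkeleton (m + 1) :=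
  (refineIncr m δ.1, refineIncr m δ.2)

/-- `refineIncr` of the zero skeleton. [folklore] -/
theorem refineIncr_zero : refineIncr m (0 : Fin (2 ^ m) → ℝ) = 0 := by
  funext j
  simp [refineIncr]

/-- **Refinement of a coordinate vector**: `refineIncr (e_k) = ½ (e_{2k} + e_{2k+1})`.
[folklore] -/
theorem refineIncr_single (k : Fin (2 ^ m)) :
    refineIncr m (Pi.single k (1 : ℝ)) =
      (1 / 2 : ℝ) • ((Pi.single (childFin m k 0) (1 : ℝ) : Fin (2 ^ (m + 1)) → ℝ) +
        Pi.single (childFin m k 1) 1) := by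
  funext j
  simp only [refineIncr, Pi.smul_apply, Pi.add_apply, smul_eq_mul, Pi.single_apply, Fin.ext_iff,
    childFin_val, Fin.val_zero, Fin.val_one]
  split_ifs <;> norm_num <;> omega

/-- **Refinement of a basis vector**: `refinePair (b_j) = ½ (b'_{j₀} + b'_{j₁})` with `j₀, j₁`
the children of `j`. [folklore] -/
theorem refinePair_basisX (j : Fin (2 ^ m) ⊕ Fin (2 ^ m)) :
    refinePair m (basisX m j) =
      (1 / 2 : ℝ) • (basisX (m + 1) (childIdx m 0 j) + basisX (m + 1) (childIdx m 1 j)) := by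
  cases j with
  | inl k =>
    simp [refinePair, basisX, childIdx, refineIncr_single, refineIncr_zero]
  | inr k =>
    simp [refinePair, basisX, childIdx, refineIncr_single, refineIncr_zero]

end Refine

section RefineFlow

variable {ω₂ lam β γ : ℝ} (hω : 0 < ω₂) (hl : 0 ≤ lam) (hβ : 0 ≤ β) (hγ : 0 ≤ γ) (N : ℕ)
  (T_L T_R : ℝ)

include hω hl hβ hγ

/-- **(I-s5) The refinement identity at time `s ∈ [0, 1]`** along the driving path:
`D E^{s}_{m+1}(Ξ_{m+1} wp)[refinePair δ] = D E^{s}_m(Ξ_m wp)[δ]` — a level-`m` direction refines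
to a level-`m+1` direction with the same forcing (`skelForcing_refine`), hence the same
variational solution (`variational_unique`); the tree's `range_fderiv_skelFlowMap_mono` is the
case `s = 1`, stated for ranges. [folklore] -/
theorem fderiv_skelFlowMapAt_refinePair {s : ℝ} (hs : s ∈ Icc (0 : ℝ) 1) (m : ℕ)
    (z : PhaseSpace N) (wp : WienerPair) (δ : PairSkeleton m) :
    fderiv ℝ (skelFlowMapAt ω₂ lam β γ N T_L T_R s (m + 1) z (pairRem (m + 1) wp))
        (pairSkel (m + 1) wp) (refinePair m δ) =
      fderiv ℝ (skelFlowMapAt ω₂ lam β γ N T_L T_R s m z (pairRem m wp)) (pairSkel m wp) δ := by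
  rw [fderiv_skelFlowMapAt_apply hω hl hβ hγ N T_L T_R hs,
    fderiv_skelFlowMapAt_apply hω hl hβ hγ N T_L T_R hs]
  refine variational_unique N (continuous_fderiv_drift_solMap hω hl hβ hγ N T_L T_R z wp)
    (continuous_pinnedChainVariation hω hl hβ hγ N z _ _ _ _)
    (continuous_pinnedChainVariation hω hl hβ hγ N z _ _ _ _)
    (φ := fun τ => (((0 : Fin N → ℝ), IccExtend zero_le_one
      (skelForcing N m (ampL ω₂ lam β γ T_L) (ampR ω₂ lam β γ T_R) δ) τ) : PhaseSpace N))
    (fun τ hτ => ?_) (fun τ hτ => ?_) hs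
  · rw [pinnedChainVariation_eq_solMap hω hl hβ hγ N T_L T_R (m + 1) z wp _ hτ, refinePair,
      skelForcing_refine, IccExtend_of_mem _ _ hτ]
  · rw [pinnedChainVariation_eq_solMap hω hl hβ hγ N T_L T_R m z wp δ hτ, IccExtend_of_mem _ _ hτ]

end RefineFlow

/-! ## 3. Loewner monotonicity of the normalised Gram matrices along the path -/

section Gram

/-- R's normalised Gram matrix `Γ^{s}_m` **along the driving path** (remainder and skeleton of
the same `wp`). [folklore] -/
def skelGramPath (ω₂ lam β γ : ℝ) (N : ℕ) (T_L T_R : ℝ) (s : ℝ) (m : ℕ) (z : PhaseSpace N)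
    (wp : WienerPair) : Matrix (Fin N ⊕ Fin N) (Fin N ⊕ Fin N) ℝ :=
  skelGramAt ω₂ lam β γ N T_L T_R s m z (pairRem m wp) (pairSkel m wp)

variable {ω₂ lam β γ : ℝ} {N : ℕ} {T_L T_R : ℝ} {s : ℝ} {m : ℕ}

/-- Unfolding `skelGramPath`. [folklore] -/
theorem skelGramPath_eq (z : PhaseSpace N) (wp : WienerPair) :
    skelGramPath ω₂ lam β γ N T_L T_R s m z wp =
      skelGramAt ω₂ lam β γ N T_L T_R s m z (pairRem m wp) (pairSkel m wp) := rfl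

/-- **The quadratic form of the normalised Gram matrix**:
`gᵀ Γ g = 2^{-m} Σ_j ⟨c_g, D E^{s}_m(x)[b_j]⟩²`, `c_g = ofCoordV g`. [folklore] -/
theorem dotProduct_skelGramAt_mulVec (z : PhaseSpace N) (r : WienerPair) (x : PairSkeleton m)
    (g : Fin N ⊕ Fin N → ℝ) :
    g ⬝ᵥ (skelGramAt ω₂ lam β γ N T_L T_R s m z r x *ᵥ g) =
      ((2 : ℝ) ^ m)⁻¹ * ∑ j, (dualPair (ofCoordV N g)
        (fderiv ℝ (skelFlowMapAt ω₂ lam β γ N T_L T_R s m z r) x (basisX m j))) ^ 2 := by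
  have hJ : ∀ j, (g ᵥ* skelJacAt ω₂ lam β γ N T_L T_R s m z r x) j =
      dualPair (ofCoordV N g)
        (fderiv ℝ (skelFlowMapAt ω₂ lam β γ N T_L T_R s m z r) x (basisX m j)) := by
    intro j
    have h := coordV_vecMul_jacMat (fderiv ℝ (skelFlowMapAt ω₂ lam β γ N T_L T_R s m z r) x :
      PairSkeleton m →ₗ[ℝ] PhaseSpace N) (ofCoordV N g) j
    rw [coordV_ofCoordV] at h
    exact h
  rw [skelGramAt, Matrix.smul_mulVec, dotProduct_smul, smul_eq_mul, ← Matrix.mulVec_mulVec,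
    Matrix.dotProduct_mulVec, Matrix.mulVec_transpose]
  congr 1
  simp only [dotProduct, hJ, sq]

/-- **Onto ⟹ positive definite**: if `D E^{s}_m(x)` is onto phase space then `Γ ≻ 0` (the hook
through which (I-s2) at time `s` enters the defect bounds of file 4). [folklore] -/
theorem posDef_skelGramAt_of_range_eq_top (z : PhaseSpace N) (r : WienerPair)
    (x : PairSkeleton m)
    (h : LinearMap.range (fderiv ℝ (skelFlowMapAt ω₂ lam β γ N T_L T_R s m z r) x :
      PairSkeleton m →ₗ[ℝ] PhaseSpace N) = ⊤) :
    (skelGramAt ω₂ lam β γ N T_L T_R s m z r x).PosDef := by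
  refine Matrix.PosDef.of_dotProduct_mulVec_pos (posSemidef_skelGramAt z r x).isHermitian
    fun g hg => ?_
  rw [star_trivial, dotProduct_skelGramAt_mulVec]
  refine mul_pos (by positivity) ?_
  by_contra hle
  rw [not_lt] at hle
  have hsum0 : ∑ j, (dualPair (ofCoordV N g)
      (fderiv ℝ (skelFlowMapAt ω₂ lam β γ N T_L T_R s m z r) x (basisX m j))) ^ 2 = 0 :=
    le_antisymm hle (Finset.sum_nonneg fun j _ => sq_nonneg _)
  have hzero : ∀ j, dualPair (ofCoordV N g)
      (fderiv ℝ (skelFlowMapAt ω₂ lam β γ N T_L T_R s m z r) x (basisX m j)) = 0 := fun j =>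
    (pow_eq_zero_iff two_ne_zero).1
      ((Finset.sum_eq_zero_iff_of_nonneg fun j _ => sq_nonneg _).1 hsum0 j (Finset.mem_univ j))
  have hall : ∀ v, dualPair (ofCoordV N g) v = 0 := fun v => by
    obtain ⟨δ, rfl⟩ : v ∈ LinearMap.range
        (fderiv ℝ (skelFlowMapAt ω₂ lam β γ N T_L T_R s m z r) x :
          PairSkeleton m →ₗ[ℝ] PhaseSpace N) := by
      rw [h]
      trivial
    exact dualPair_eq_zero_of_basisX _ hzero δ
  have hc : ofCoordV N g = 0 := eq_zero_of_forall_dualPair_eq_zero hall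
  exact hg (by rw [← coordV_ofCoordV N g, hc, coordV_zero])

/-- `Σ_j q_j² ≤ ½ Σ_{j'} p_{j'}²` when each `q_j` is the mean of two of the `p`'s and the `p`'s
regroup by these pairs. [folklore] -/
theorem sum_sq_half_add_le {ι ι' : Type} [Fintype ι] [Fintype ι'] (p : ι' → ℝ) (q : ι → ℝ)
    (c₀ c₁ : ι → ι') (hq : ∀ j, q j = (1 / 2 : ℝ) * (p (c₀ j) + p (c₁ j)))
    (hsum : ∑ j', p j' ^ 2 = ∑ j, (p (c₀ j) ^ 2 + p (c₁ j) ^ 2)) :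
    ∑ j, q j ^ 2 ≤ (1 / 2 : ℝ) * ∑ j', p j' ^ 2 := by
  rw [hsum, Finset.mul_sum]
  refine Finset.sum_le_sum fun j _ => ?_
  rw [hq]
  nlinarith [sq_nonneg (p (c₀ j) - p (c₁ j))]

end Gram

section GramMono

variable {ω₂ lam β γ : ℝ} (hω : 0 < ω₂) (hl : 0 ≤ lam) (hβ : 0 ≤ β) (hγ : 0 ≤ γ) (N : ℕ)
  (T_L T_R : ℝ)

include hω hl hβ hγ

/-- **A level-`m` pairing is the mean of its two children's** (§2 refinement identity,
`refinePair_basisX`, linearity). [folklore] -/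
theorem dualPair_fderiv_basisX_refine {s : ℝ} (hs : s ∈ Icc (0 : ℝ) 1) (m : ℕ)
    (z : PhaseSpace N) (wp : WienerPair) (c : PhaseSpace N) (j : Fin (2 ^ m) ⊕ Fin (2 ^ m)) :
    dualPair c (fderiv ℝ (skelFlowMapAt ω₂ lam β γ N T_L T_R s m z (pairRem m wp))
        (pairSkel m wp) (basisX m j)) =
      (1 / 2 : ℝ) * (dualPair c (fderiv ℝ
          (skelFlowMapAt ω₂ lam β γ N T_L T_R s (m + 1) z (pairRem (m + 1) wp))
          (pairSkel (m + 1) wp) (basisX (m + 1) (childIdx m 0 j))) +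
        dualPair c (fderiv ℝ
          (skelFlowMapAt ω₂ lam β γ N T_L T_R s (m + 1) z (pairRem (m + 1) wp))
          (pairSkel (m + 1) wp) (basisX (m + 1) (childIdx m 1 j)))) := by
  rw [← fderiv_skelFlowMapAt_refinePair hω hl hβ hγ N T_L T_R hs m z wp (basisX m j),
    refinePair_basisX, map_smul, map_add, dualPair_smul_right, dualPair_add_right]

/-- **`gᵀ Γ_m g ≤ gᵀ Γ_{m+1} g` along the path**, every `s ∈ [0, 1]`. [folklore] -/
theorem dotProduct_skelGramAt_mulVec_le_succ {s : ℝ} (hs : s ∈ Icc (0 : ℝ) 1) (m : ℕ)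
    (z : PhaseSpace N) (wp : WienerPair) (g : Fin N ⊕ Fin N → ℝ) :
    g ⬝ᵥ (skelGramAt ω₂ lam β γ N T_L T_R s m z (pairRem m wp) (pairSkel m wp) *ᵥ g) ≤
      g ⬝ᵥ (skelGramAt ω₂ lam β γ N T_L T_R s (m + 1) z (pairRem (m + 1) wp)
        (pairSkel (m + 1) wp) *ᵥ g) := by
  rw [dotProduct_skelGramAt_mulVec, dotProduct_skelGramAt_mulVec, pow_succ, mul_inv, mul_assoc]
  refine mul_le_mul_of_nonneg_left ?_ (by positivity)
  have h := sum_sq_half_add_le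
    (fun j' => dualPair (ofCoordV N g) (fderiv ℝ
      (skelFlowMapAt ω₂ lam β γ N T_L T_R s (m + 1) z (pairRem (m + 1) wp))
      (pairSkel (m + 1) wp) (basisX (m + 1) j')))
    (fun j => dualPair (ofCoordV N g) (fderiv ℝ
      (skelFlowMapAt ω₂ lam β γ N T_L T_R s m z (pairRem m wp)) (pairSkel m wp) (basisX m j)))
    (childIdx m 0) (childIdx m 1)
    (fun j => dualPair_fderiv_basisX_refine hω hl hβ hγ N T_L T_R hs m z wp (ofCoordV N g) j)
    (sum_childIdx m _)
  simpa only [one_div] using h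

/-- **Loewner monotonicity in the level along the path** (quadratic-form version):
`gᵀ Γ_{m'} g ≤ gᵀ Γ_m g` for `m' ≤ m`. [folklore] -/
theorem dotProduct_skelGramPath_mulVec_mono {s : ℝ} (hs : s ∈ Icc (0 : ℝ) 1) (z : PhaseSpace N)
    (wp : WienerPair) (g : Fin N ⊕ Fin N → ℝ) {m' m : ℕ} (h : m' ≤ m) :
    g ⬝ᵥ (skelGramPath ω₂ lam β γ N T_L T_R s m' z wp *ᵥ g) ≤
      g ⬝ᵥ (skelGramPath ω₂ lam β γ N T_L T_R s m z wp *ᵥ g) := by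
  induction h with
  | refl => exact le_rfl
  | step _ ih =>
    exact ih.trans (dotProduct_skelGramAt_mulVec_le_succ hω hl hβ hγ N T_L T_R hs _ z wp g)

/-- **Loewner monotonicity in the level along the path**: `Γ_m − Γ_{m'} ⪰ 0` for `m' ≤ m`.
[folklore] -/
theorem posSemidef_skelGramPath_sub {s : ℝ} (hs : s ∈ Icc (0 : ℝ) 1) (z : PhaseSpace N)
    (wp : WienerPair) {m' m : ℕ} (h : m' ≤ m) :
    (skelGramPath ω₂ lam β γ N T_L T_R s m z wp -
      skelGramPath ω₂ lam β γ N T_L T_R s m' z wp).PosSemidef := by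
  refine Matrix.PosSemidef.of_dotProduct_mulVec_nonneg
    ((posSemidef_skelGramAt z _ _).isHermitian.sub (posSemidef_skelGramAt z _ _).isHermitian)
    fun x => ?_
  rw [star_trivial, Matrix.sub_mulVec, dotProduct_sub, sub_nonneg]
  exact dotProduct_skelGramPath_mulVec_mono hω hl hβ hγ N T_L T_R hs z wp x h

end GramMono

end Summit.AtomisticToContinuum.FouriersLaw.Theorems.ExtensiveSnapshotIrreversibility.EnergyWindow
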